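import Literature.Probability.Distributions.PseudoGaussianSampler
import Literature.Computability.Complexity.DiagPrelims
import Mathlib.Data.Vector.Basic
import HarnessLib

/-!
# The pseudo-Gaussian sampler on flat coin strings

Topic `Probability/Distributions`, sequel of `PseudoGaussianSampler.lean`. There the sampler with
parameters `P : PGParams` reads STRUCTURED coins `Fin J → AttemptCoins`,
`AttemptCoins = Fin (2T) × (Fin Mmax → Fin 2ᵏ)`, and its exact law `PGParams.law` is a count over
them (`cntFirst`). A machine reads a flat string of coin BITS. This file defines the sampler on bit
strings, by the same arithmetic a machine performs (values of blocks, least significant bit first,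
`bitsToNat`), and proves that on strings of the right length it is the structured sampler composed
with a BIJECTIVE decoding — so that its law under uniform bits is `law` exactly:

* lengths `hdrLen = r + b + 1` (`2T = 2^{hdrLen}` values of the magnitude field), `attLen`
  (one attempt: header, then `Mmax` acceptance blocks of `k` bits), `coinLen = J · attLen`;
* `magVal`, `accVal`, `attemptFlat` (an attempt on a block, as a pair `(accepted?, value)`),
  `samplerFlat` (the first accepted value among the `J` blocks, default `0`, as a left fold `pick`);
* `attemptFlat_eq`, **`samplerFlat_eq`** — `samplerFlat w = sampler (decodeCoins w)` for EVERY
  string `w` (short blocks decode to small values; nothing is claimed about their law);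
* `decodeCoins_bijective` — on `{0,1}^{coinLen}` the decoding is a bijection onto
  `Fin J → AttemptCoins` (blocks determine the string, `eq_of_bitsToNat_eq`; cardinalities agree);
* **`card_samplerFlat_eq`** — `#{w ∈ {0,1}^{coinLen} | samplerFlat w = j} = law j · 2^{coinLen}`.

All proved.

## References

* S. Aaronson, A. Arkhipov, *The computational complexity of linear optics*, Theory of Computing 9
  (2013) 143–252, Thm. 1.1 (p. 149: a randomised machine is a deterministic one reading a random
  string) and §5.2.
-/

namespace Literature.Probability.Distributions

open Finset Literature.Computability.Complexity

/-! ### The first success as a left fold over pairs -/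

section Pick

/-- An optional value as a pair `(found?, value)` (`none ↦ (false, 0)`). [folklore] -/
def optPair : Option ℤ → Bool × ℤ
  | some j => (true, j)
  | none => (false, 0)

/-- Keep the first found value. [folklore] -/
def pick (st o : Bool × ℤ) : Bool × ℤ := if st.1 then st else o

/-- Once found, the fold is constant. [folklore] -/
theorem foldl_pick_of_fst (l : List (Bool × ℤ)) (st : Bool × ℤ) (h : st.1 = true) : l.foldl pick st = st := by
  induction l generalizing st with
  | nil => rfl
  | cons a l ih => rw [List.foldl_cons, show pick st a = st by simp [pick, h], ih st h]

/-- **`firstSome` is the `pick`-fold of the pairs.** [folklore] -/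
theorem firstSome_eq_foldl_pick (l : List (Option ℤ)) :
    firstSome l = ((l.map optPair).foldl pick (false, 0)).2 := by
  induction l with
  | nil => rfl
  | cons o l ih =>
    cases o with
    | some j =>
      rw [List.map_cons, List.foldl_cons, show pick (false, 0) (optPair (some j)) = (true, j) by rfl,
        foldl_pick_of_fst _ _ rfl]
      rfl
    | none =>
      rw [List.map_cons, List.foldl_cons, show pick (false, 0) (optPair none) = (false, 0) by rfl, ← ih]
      rfl

end Pick

/-! ### Strings determined by their blocks -/

/-- A string of length `J · A` is determined by its `J` consecutive blocks of length `A`. [folklore] -/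
theorem eq_of_blocks_eq {J A : ℕ} : ∀ {l l' : List Bool}, l.length = J * A → l'.length = J * A →
    (∀ t < J, (l.drop (t * A)).take A = (l'.drop (t * A)).take A) → l = l' := by
  induction J with
  | zero =>
    intro l l' hl hl' _
    rw [Nat.zero_mul, List.length_eq_zero_iff] at hl hl'
    rw [hl, hl']
  | succ J ih =>
    intro l l' hl hl' h
    have h0 := h 0 (Nat.succ_pos J)
    simp only [Nat.zero_mul, List.drop_zero] at h0
    have htail : l.drop A = l'.drop A := by
      refine ih (by rw [List.length_drop, hl]; rw [Nat.succ_mul]; omega)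
        (by rw [List.length_drop, hl']; rw [Nat.succ_mul]; omega) fun t ht => ?_
      have := h (t + 1) (by omega)
      rwa [Nat.succ_mul, Nat.add_comm, ← List.drop_drop, ← List.drop_drop] at this
    rw [← List.take_append_drop A l, ← List.take_append_drop A l', h0, htail]

namespace PGParams

variable (P : PGParams)

/-! ### Lengths -/

/-- The magnitude field has `r + b + 1` bits. [folklore] -/
def hdrLen : ℕ := P.r + P.b + 1

/-- One attempt reads `hdrLen + Mmax · k` bits. [folklore] -/
def attLen : ℕ := P.hdrLen + P.Mmax * P.k

/-- The sampler reads `J · attLen` bits. [folklore] -/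
def coinLen : ℕ := P.J * P.attLen

/-- `2T = 2^{hdrLen}`. [folklore] -/
theorem two_mul_T : 2 * P.T = 2 ^ P.hdrLen := by
  unfold T hdrLen; rw [pow_succ]; ring

/-! ### The flat attempt and sampler -/

/-- The value of the magnitude field of an attempt block. [folklore] -/
def magVal (w : List Bool) : ℕ := bitsToNat (w.take P.hdrLen)

/-- The `i`-th acceptance block of an attempt block. [folklore] -/
def accBlock (w : List Bool) (i : ℕ) : List Bool := ((w.drop P.hdrLen).drop (i * P.k)).take P.k

/-- The value of the `i`-th acceptance block. [folklore] -/
def accVal (w : List Bool) (i : ℕ) : ℕ := bitsToNat (P.accBlock w i)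

/-- The magnitude value is `< 2T`, on every string. [folklore] -/
theorem magVal_lt (w : List Bool) : P.magVal w < 2 * P.T := by
  rw [two_mul_T]
  refine lt_of_lt_of_le (bitsToNat_lt _) (Nat.pow_le_pow_right (by norm_num) ?_)
  rw [List.length_take]; exact min_le_left _ _

/-- An acceptance value is `< 2ᵏ`, on every string. [folklore] -/
theorem accVal_lt (w : List Bool) (i : ℕ) : P.accVal w i < 2 ^ P.k := by
  refine lt_of_lt_of_le (bitsToNat_lt _) (Nat.pow_le_pow_right (by norm_num) ?_)
  rw [accBlock, List.length_take]; exact min_le_left _ _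

/-- The structured attempt coins read off an attempt block. [folklore] -/
def decodeAtt (w : List Bool) : P.AttemptCoins :=
  (⟨P.magVal w, P.magVal_lt w⟩, fun i => ⟨P.accVal w i, P.accVal_lt w i⟩)

/-- **The attempt on a block**, as the pair `(accepted?, value)`: reject the magnitude value `0`;
otherwise propose `j = v - T` and accept iff the first `M(|j|)` acceptance blocks are nonzero.
[folklore] -/
def attemptFlat (w : List Bool) : Bool × ℤ :=
  if P.magVal w = 0 then (false, 0)
  else if ∀ i < P.M (((P.magVal w : ℕ) : ℤ) - P.T).natAbs, P.accVal w i ≠ 0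
    then (true, ((P.magVal w : ℕ) : ℤ) - P.T) else (false, 0)

/-- A proposed value has magnitude `< T`. [folklore] -/
theorem natAbs_sub_T_lt {v : ℕ} (hv : v < 2 * P.T) (hv0 : v ≠ 0) : ((v : ℤ) - P.T).natAbs < P.T := by
  omega

/-- **The flat attempt is the structured attempt on the decoded coins**, on every string. [folklore] -/
theorem attemptFlat_eq (w : List Bool) : P.attemptFlat w = optPair (P.attempt (P.decodeAtt w)) := by
  unfold attemptFlat attempt decodeAtt
  simp only
  by_cases h0 : P.magVal w = 0
  · rw [if_pos h0, if_pos h0]; rfl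
  · rw [if_neg h0, if_neg h0]
    have hM : P.M (((P.magVal w : ℕ) : ℤ) - P.T).natAbs < P.Mmax :=
      P.M_lt_Mmax (P.natAbs_sub_T_lt (P.magVal_lt w) h0)
    have hiff : (∀ i < P.M (((P.magVal w : ℕ) : ℤ) - P.T).natAbs, P.accVal w i ≠ 0) ↔
        ∀ i : Fin P.Mmax, (i : ℕ) < P.M (((P.magVal w : ℕ) : ℤ) - P.T).natAbs →
          (⟨P.accVal w i, P.accVal_lt w i⟩ : Fin (2 ^ P.k)) ≠ 0 := by
      constructor
      · intro h i hi hz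
        exact h i hi (by simpa using congrArg Fin.val hz)
      · intro h i hi hz
        exact h ⟨i, hi.trans hM⟩ hi (Fin.ext (by simpa using hz))
    by_cases hacc : ∀ i < P.M (((P.magVal w : ℕ) : ℤ) - P.T).natAbs, P.accVal w i ≠ 0
    · rw [if_pos hacc, if_pos (hiff.1 hacc)]; rfl
    · rw [if_neg hacc, if_neg (fun h => hacc (hiff.2 h))]; rfl

/-- The `t`-th attempt block of a coin string. [folklore] -/
def attBlock (w : List Bool) (t : ℕ) : List Bool := (w.drop (t * P.attLen)).take P.attLen

/-- The structured coins read off a coin string. [folklore] -/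
def decodeCoins (w : List Bool) (t : Fin P.J) : P.AttemptCoins := P.decodeAtt (P.attBlock w t)

/-- **The sampler on a coin string**: the first accepted value among the `J` attempt blocks
(default `0`), as a left fold. [folklore] -/
def samplerFlat (w : List Bool) : ℤ :=
  (((List.range P.J).map fun t => P.attemptFlat (P.attBlock w t)).foldl pick (false, 0)).2

/-- **The flat sampler is the structured sampler on the decoded coins**, on every string. [folklore] -/
theorem samplerFlat_eq (w : List Bool) : P.samplerFlat w = P.sampler (P.decodeCoins w) := by
  rw [sampler, firstSuccess, firstSome_eq_foldl_pick, samplerFlat, List.ofFn_eq_map, List.map_map,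
    ← List.map_coe_finRange_eq_range, List.map_map]
  congr 3
  funext t
  simp only [Function.comp_apply, attemptFlat_eq]
  rfl

/-! ### The decoding is a bijection on strings of the right length -/

/-- An attempt block of full length is determined by its decoded coins. [folklore] -/
theorem eq_of_decodeAtt_eq {v w : List Bool} (hv : v.length = P.attLen) (hw : w.length = P.attLen)
    (h : P.decodeAtt v = P.decodeAtt w) : v = w := by
  have h1 : P.magVal v = P.magVal w := by simpa [decodeAtt] using congrArg (fun c => (c.1 : ℕ)) h
  have h2 : ∀ i : Fin P.Mmax, P.accVal v i = P.accVal w i := fun i => by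
    simpa [decodeAtt] using congrArg (fun c => (c.2 i : ℕ)) h
  -- header
  have hhdr : v.take P.hdrLen = w.take P.hdrLen := by
    refine DiagPrelims.eq_of_bitsToNat_eq ?_ h1
    rw [List.length_take, List.length_take, hv, hw]
  -- tail, block by block
  have htl : v.drop P.hdrLen = w.drop P.hdrLen := by
    refine eq_of_blocks_eq (J := P.Mmax) (A := P.k) (by rw [List.length_drop, hv, attLen]; omega)
      (by rw [List.length_drop, hw, attLen]; omega) fun t ht => ?_
    have hlen : ∀ {u : List Bool}, u.length = P.attLen →
        (((u.drop P.hdrLen).drop (t * P.k)).take P.k).length = P.k := by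
      intro u hu
      rw [List.length_take, List.length_drop, List.length_drop, hu, attLen]
      have : (t + 1) * P.k ≤ P.Mmax * P.k := Nat.mul_le_mul_right _ ht
      rw [Nat.succ_mul] at this
      omega
    exact DiagPrelims.eq_of_bitsToNat_eq (by rw [hlen hv, hlen hw]) (h2 ⟨t, ht⟩)
  rw [← List.take_append_drop P.hdrLen v, ← List.take_append_drop P.hdrLen w, hhdr, htl]

/-- A coin string of full length is determined by its decoded coins. [folklore] -/
theorem eq_of_decodeCoins_eq {v w : List Bool} (hv : v.length = P.coinLen) (hw : w.length = P.coinLen)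
    (h : P.decodeCoins v = P.decodeCoins w) : v = w := by
  refine eq_of_blocks_eq (J := P.J) (A := P.attLen) hv hw fun t ht => ?_
  have hlen : ∀ {u : List Bool}, u.length = P.coinLen → ((u.drop (t * P.attLen)).take P.attLen).length = P.attLen := by
    intro u hu
    rw [List.length_take, List.length_drop, hu, coinLen]
    have : (t + 1) * P.attLen ≤ P.J * P.attLen := Nat.mul_le_mul_right _ ht
    rw [Nat.succ_mul] at this
    omega
  exact P.eq_of_decodeAtt_eq (hlen hv) (hlen hw) (congrFun h ⟨t, ht⟩)

/-- The number of attempt coins is `2^{attLen}`. [folklore] -/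
theorem card_attemptCoins_eq_pow : Fintype.card P.AttemptCoins = 2 ^ P.attLen := by
  rw [card_attemptCoins, two_mul_T, attLen, pow_add, ← pow_mul, mul_comm P.k]

/-- **On `{0,1}^{coinLen}` the decoding is a bijection onto the structured coins.** [folklore] -/
theorem decodeCoins_bijective :
    Function.Bijective fun v : List.Vector Bool P.coinLen => P.decodeCoins v.toList := by
  rw [Fintype.bijective_iff_injective_and_card]
  constructor
  · intro v w h
    exact List.Vector.toList_injective (P.eq_of_decodeCoins_eq v.toList_length w.toList_length h)
  · rw [card_vector, Fintype.card_bool, Fintype.card_fun, Fintype.card_fin, card_attemptCoins_eq_pow,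
      ← pow_mul, coinLen, mul_comm]

/-- **Counting through the decoding**: for every property `Q` of structured coins,
`#{v ∈ {0,1}^{coinLen} | Q (decodeCoins v)} = #{c | Q c}`. [folklore] -/
theorem card_filter_decodeCoins (Q : (Fin P.J → P.AttemptCoins) → Prop) [DecidablePred Q] :
    (univ.filter fun v : List.Vector Bool P.coinLen => Q (P.decodeCoins v.toList)).card =
      (univ.filter Q).card := by
  refine card_bij (fun v _ => P.decodeCoins v.toList) (fun v hv => by simpa using hv)
    (fun v _ w _ h => (P.decodeCoins_bijective).1 h) fun c hc => ?_
  obtain ⟨v, hv⟩ := (P.decodeCoins_bijective).2 c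
  simp only at hv
  exact ⟨v, by simp only [mem_filter, mem_univ, true_and] at hc ⊢; rw [hv]; exact hc, hv⟩

/-- **The law of the flat sampler under uniform bits is `law`**:
`#{v ∈ {0,1}^{coinLen} | samplerFlat v = j} = law j · 2^{coinLen}`. [folklore] -/
theorem card_samplerFlat_eq (j : ℤ) :
    ((univ.filter fun v : List.Vector Bool P.coinLen => P.samplerFlat v.toList = j).card : ℝ) =
      P.law j * 2 ^ P.coinLen := by
  have h := P.card_filter_decodeCoins (fun c => P.sampler c = j)
  simp only [← samplerFlat_eq] at h
  rw [h, law, cntFirst, card_attemptCoins_eq_pow]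
  have hpow : ((2 ^ P.attLen : ℕ) : ℝ) ^ P.J = 2 ^ P.coinLen := by
    rw [coinLen, mul_comm, pow_mul]; push_cast; ring
  rw [hpow, div_mul_cancel₀ _ (by positivity)]
  rfl

end PGParams

end Literature.Probability.Distributions
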